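import Mathlib
import Summits.MatrixMultiplication.MatrixMultiplication.Theses.FourierTwoFamiliesModP
import Summits.MatrixMultiplication.MatrixMultiplication.Theorems.FourierTwoFamiliesModPCyclicReductionTransfer
import Literature.Computability.AlgebraicComplexity.SimultaneousDoubleProduct

/-!
# Self-converse gadgets `↔ PrimeTwoFamilies` — the explicit, elementary route

Item `stmt-MatrixMultiplication-14308` (`FourierTwoFamiliesModP.PrimeTwoFamilies`, CKSU 2005 Conj. 4.7 with
prime cyclic hosts), registered stub `selfConverseGadgets_iff_primeTwoFamilies` (siege, variation
"explicit / elementary").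

A *self-converse gadget* at level `m` is a list of `r` DIRECT pairs `(P c, Q c)_{c<r}` in `ℤ/m`
(`(x - x') + (y - y') = 0` inside one pair forces `x = x'`, `y = y'`; letters may coincide) with a map
`π : Fin r → Fin r` such that every ordered pair of distinct letters `σ ≠ τ` is STRONGLY SEPARATED — every
cross difference `q - p` (`p ∈ P σ`, `q ∈ Q τ`) avoids every diagonal difference `q' - p'` (`p' ∈ P c`,
`q' ∈ Q c`) — either directly or after applying `π`; the hypothesis asks for `m^{1-ε} ≤ r` letters of
co-volume `|P c| |Q c| ≥ m^{1-ε}` beyond every `m₀`, for every `ε > 0`.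

This file proves the equivalence with the crux by two EXPLICIT one-level constructions and EXPLICIT
exponent bookkeeping, independently of the capacity-gadget (code-lift) pipeline:

* `repetition_separated` (crux ⇒ gadgets, one level, LETTER REPETITION): an SDPP family `(A i, B i)_{i<n}`
  read through any injective labelling `c ↦ (f c, g c)` of the letters, `P c = A (f c)`, `Q c = B (f c)`,
  and any `π` with `f ∘ π = g`, is a self-converse gadget: clause (X) separates letters with `f σ ≠ f τ`
  directly and letters with `g σ ≠ g τ` after `π` (`cross_ne_diag_of_cross`).  With `f, g` the two
  projections of `Fin (n·n) ≃ Fin n × Fin n` this gives `r = n²` letters in `ℤ/p`, `m = p`.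
* `family_of_gadget` (gadgets ⇒ crux, one level, GRAPH LIFT at word length 2): the blocks
  `A c = P c × P (π c)`, `B c = Q c × Q (π c)` in `(ℤ/m)²` (as `Fin 2 → ℤ/m`, `graphLift_direct`,
  `graphLift_cross`) satisfy (W) coordinatewise and (X) at coordinate `0` (direct separation) or `1`
  (separation after `π`); the carry-free transfer `exists_prime_sdpp_of_addEquiv` (route support
  CyclicReduction) moves them into `ℤ/p'` for a prime `p' ≤ 18 m²`, with `|A c| = |P c| |P (π c)|`,
  `|B c| = |Q c| |Q (π c)|`.
* `bookkeeping` (explicit exponents): for `0 < δ ≤ 1` take `ε = δ/8`, keep `n = ⌈m^{1-ε}⌉₊ ≤ r` blocks;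
  as soon as `18 ≤ m^{5δ/8}` and `n₀² ≤ m` one has `n₀ ≤ n`, `p' ≤ 18 m² ≤ n^{2+δ}` and
  `n^{2-δ} ≤ m^{1-ε} · m^{1-ε} ≤ |A c| |B c|`.  Conversely the slice `δ = ε'/2`, `ε' = min ε 1`, of the
  crux gives gadgets of slice `ε`: `p^{1-ε} ≤ p^{1-ε'} ≤ n^{(2+δ)(1-ε')} ≤ n^{2-δ} ≤ |A i| |B i|` and
  `n^{2-δ} ≤ n² = r`.

An independent second derivation of the tree's `CapacityLift.selfConverseGadgets_iff_primeTwoFamilies`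
(which goes through zero-error codes of general word length); only `exists_prime_sdpp_of_addEquiv`
(Freiman-isomorphic embedding into a Bertrand prime) and `card_mul_card_le_of_dpp` (CKSU Prop. 4.6) are
imported.
-/

-- single-conjunct summit: the mandated namespace repeats `MatrixMultiplication` (summit = sub-problem).
set_option linter.dupNamespace false

namespace Summit.MatrixMultiplication.MatrixMultiplication.Theorems.PrimeTwoFamilies.SelfConverseExplicitK2

open Finset
open Summit.MatrixMultiplication.MatrixMultiplication.Theses
open Literature.Computability.AlgebraicComplexity

section Combinatorics

variable {K : Type*} [AddCommGroup K]

/-- Clause (X) of the SDPP read as STRONG SEPARATION: for indices `i ≠ k`, every cross difference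
`y - x` (`x ∈ A i`, `y ∈ B k`) differs from every diagonal difference `y' - x'` (`x' ∈ A j`, `y' ∈ B j`)
— clause (X) at `(i, j, k)` applied to `(x - x') + (y' - y) = 0`. -/
theorem cross_ne_diag_of_cross {n : ℕ} {A B : Fin n → Finset K}
    (hX : ∀ i j k : Fin n, ∀ a ∈ A i, ∀ a' ∈ A j, ∀ b ∈ B j, ∀ b' ∈ B k,
      (a - a') + (b - b') = 0 → i = k)
    {i k : Fin n} (hik : i ≠ k) :
    ∀ x ∈ A i, ∀ y ∈ B k, ∀ j : Fin n, ∀ x' ∈ A j, ∀ y' ∈ B j, y - x ≠ y' - x' := by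
  intro x hx y hy j x' hx' y' hy' heq
  refine hik (hX i j k x hx x' hx' y' hy' y hy ?_)
  have h : (x - x') + (y' - y) = (y' - x') - (y - x) := by abel
  rw [h, heq, sub_self]

/-- **Letter repetition** (crux ⇒ gadgets at one level, explicit).  Let `(A i, B i)_{i<n}` satisfy
clause (X), and label `r` letters by `c ↦ (f c, g c)` injectively, letter `c` carrying the pair
`(A (f c), B (f c))`; let `π : Fin r → Fin r` satisfy `f (π c) = g c`.  Then every ordered pair of
distinct letters `σ ≠ τ` is strongly separated either directly (when `f σ ≠ f τ`) or after `π` (when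
`f σ = f τ`, so that `g σ ≠ g τ`, i.e. `f (π σ) ≠ f (π τ)`). -/
theorem repetition_separated {n r : ℕ} {A B : Fin n → Finset K}
    (hX : ∀ i j k : Fin n, ∀ a ∈ A i, ∀ a' ∈ A j, ∀ b ∈ B j, ∀ b' ∈ B k,
      (a - a') + (b - b') = 0 → i = k)
    (f g : Fin r → Fin n) (π : Fin r → Fin r)
    (hfg : ∀ σ τ : Fin r, f σ = f τ → g σ = g τ → σ = τ) (hπ : ∀ c : Fin r, f (π c) = g c) :
    ∀ σ τ : Fin r, σ ≠ τ →
      (∀ p ∈ A (f σ), ∀ q ∈ B (f τ), ∀ c : Fin r, ∀ p' ∈ A (f c), ∀ q' ∈ B (f c),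
        q - p ≠ q' - p') ∨
      (∀ p ∈ A (f (π σ)), ∀ q ∈ B (f (π τ)), ∀ c : Fin r, ∀ p' ∈ A (f c), ∀ q' ∈ B (f c),
        q - p ≠ q' - p') := by
  intro σ τ hστ
  by_cases h1 : f σ = f τ
  · right
    have h2 : f (π σ) ≠ f (π τ) := by
      rw [hπ σ, hπ τ]
      exact fun h2 => hστ (hfg σ τ h1 h2)
    intro p hp q hq c p' hp' q' hq'
    exact cross_ne_diag_of_cross hX h2 p hp q hq (f c) p' hp' q' hq'
  · left
    intro p hp q hq c p' hp' q' hq'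
    exact cross_ne_diag_of_cross hX h1 p hp q hq (f c) p' hp' q' hq'

/-- **Graph lift, clause (W)** (gadgets ⇒ crux at one level, explicit, word length 2).  For direct
letters the blocks `A c = ∏_{t<2} P (![c, π c] t)` and `B c = ∏_{t<2} Q (![c, π c] t)` in `Fin 2 → K`
(i.e. `P c × P (π c)` and `Q c × Q (π c)`) are direct: clause (W) holds coordinatewise. -/
theorem graphLift_direct {r : ℕ} (P Q : Fin r → Finset K) (π : Fin r → Fin r)
    (hD : ∀ c : Fin r, ∀ x ∈ P c, ∀ x' ∈ P c, ∀ y ∈ Q c, ∀ y' ∈ Q c,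
      (x - x') + (y - y') = 0 → x = x' ∧ y = y') :
    ∀ c : Fin r, ∀ a ∈ Fintype.piFinset (fun t => P (![c, π c] t)),
      ∀ a' ∈ Fintype.piFinset (fun t => P (![c, π c] t)),
      ∀ b ∈ Fintype.piFinset (fun t => Q (![c, π c] t)),
      ∀ b' ∈ Fintype.piFinset (fun t => Q (![c, π c] t)),
        (a - a') + (b - b') = 0 → a = a' ∧ b = b' := by
  intro c a ha a' ha' b hb b' hb' h
  rw [Fintype.mem_piFinset] at ha ha' hb hb'
  have key : ∀ t, a t = a' t ∧ b t = b' t := fun t =>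
    hD _ (a t) (ha t) (a' t) (ha' t) (b t) (hb t) (b' t) (hb' t)
      (by have := congrFun h t; simpa using this)
  exact ⟨funext fun t => (key t).1, funext fun t => (key t).2⟩

/-- **Graph lift, clause (X)** (gadgets ⇒ crux at one level, explicit, word length 2).  If `π`
strongly separates every ordered pair of distinct letters either directly or after `π`, the blocks
`A c = ∏_{t<2} P (![c, π c] t)`, `B c = ∏_{t<2} Q (![c, π c] t)` satisfy clause (X): a relation
`(a - a') + (b - b') = 0` with `a ∈ A i, a' ∈ A j, b ∈ B j, b' ∈ B k`, `i ≠ k`, reads at coordinate `t`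
as the coincidence `b' t - a t = b t - a' t` of a cross difference of `(i, k)` (at `t = 0`) or of
`(π i, π k)` (at `t = 1`) with a diagonal difference of the letter `j`, resp. `π j` — forbidden. -/
theorem graphLift_cross {r : ℕ} (P Q : Fin r → Finset K) (π : Fin r → Fin r)
    (hπ : ∀ σ τ : Fin r, σ ≠ τ →
      (∀ p ∈ P σ, ∀ q ∈ Q τ, ∀ c : Fin r, ∀ p' ∈ P c, ∀ q' ∈ Q c, q - p ≠ q' - p') ∨
      (∀ p ∈ P (π σ), ∀ q ∈ Q (π τ), ∀ c : Fin r, ∀ p' ∈ P c, ∀ q' ∈ Q c, q - p ≠ q' - p')) :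
    ∀ i j k : Fin r, ∀ a ∈ Fintype.piFinset (fun t => P (![i, π i] t)),
      ∀ a' ∈ Fintype.piFinset (fun t => P (![j, π j] t)),
      ∀ b ∈ Fintype.piFinset (fun t => Q (![j, π j] t)),
      ∀ b' ∈ Fintype.piFinset (fun t => Q (![k, π k] t)),
        (a - a') + (b - b') = 0 → i = k := by
  intro i j k a ha a' ha' b hb b' hb' h
  rw [Fintype.mem_piFinset] at ha ha' hb hb'
  by_contra hik
  -- at every coordinate the relation is a coincidence of differences
  have e : ∀ t, b' t - a t = b t - a' t := fun t => by
    have key : (a t - a' t) + (b t - b' t) = 0 := by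
      have := congrFun h t; simpa using this
    have h2 : (a t - a' t) + (b t - b' t) = (b t - a' t) - (b' t - a t) := by abel
    rw [h2] at key
    exact (sub_eq_zero.1 key).symm
  rcases hπ i k hik with hs | hs
  · have ha0 := ha 0
    have hb'0 := hb' 0
    have ha'0 := ha' 0
    have hb0 := hb 0
    simp only [Matrix.cons_val_zero] at ha0 hb'0 ha'0 hb0
    exact hs (a 0) ha0 (b' 0) hb'0 j (a' 0) ha'0 (b 0) hb0 (e 0)
  · have ha1 := ha 1
    have hb'1 := hb' 1
    have ha'1 := ha' 1
    have hb1 := hb 1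
    simp only [Matrix.cons_val_one] at ha1 hb'1 ha'1 hb1
    exact hs (a 1) ha1 (b' 1) hb'1 (π j) (a' 1) ha'1 (b 1) hb1 (e 1)

omit [AddCommGroup K] in
/-- The size of a graph block: `|∏_{t<2} P (![c, π c] t)| = |P c| · |P (π c)|`. -/
theorem card_graphBlock {r : ℕ} (P : Fin r → Finset K) (π : Fin r → Fin r) (c : Fin r) :
    (Fintype.piFinset (fun t => P (![c, π c] t))).card = (P c).card * (P (π c)).card := by
  rw [Fintype.card_piFinset, Fin.prod_univ_two]
  simp

end Combinatorics

/-- **Gadgets ⇒ SDPP family in a prime cyclic group, one level, explicit.**  A self-converse gadget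
`(P c, Q c)_{c<r}`, `π` in `ℤ/m` (`m ≥ 1`) yields, for some prime `p ≤ 18 m²`, an SDPP family
`(A c, B c)_{c<r}` in `ℤ/p` (clauses (W) and (X)) with `|A c| = |P c| |P (π c)|` and
`|B c| = |Q c| |Q (π c)|`: the graph lift into `(ℤ/m)²` (`graphLift_direct`, `graphLift_cross`) followed
by the carry-free transfer `exists_prime_sdpp_of_addEquiv` with two factors `ℤ/m`
(`p ≤ 2 · 3² · m²`). -/
theorem family_of_gadget {m r : ℕ} (hm : 0 < m) (P Q : Fin r → Finset (ZMod m)) (π : Fin r → Fin r)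
    (hD : ∀ c : Fin r, ∀ x ∈ P c, ∀ x' ∈ P c, ∀ y ∈ Q c, ∀ y' ∈ Q c,
      (x - x') + (y - y') = 0 → x = x' ∧ y = y')
    (hπ : ∀ σ τ : Fin r, σ ≠ τ →
      (∀ p ∈ P σ, ∀ q ∈ Q τ, ∀ c : Fin r, ∀ p' ∈ P c, ∀ q' ∈ Q c, q - p ≠ q' - p') ∨
      (∀ p ∈ P (π σ), ∀ q ∈ Q (π τ), ∀ c : Fin r, ∀ p' ∈ P c, ∀ q' ∈ Q c, q - p ≠ q' - p')) :
    ∃ p : ℕ, p.Prime ∧ p ≤ 18 * m ^ 2 ∧ ∃ A B : Fin r → Finset (ZMod p),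
      (∀ c : Fin r, (A c).card = (P c).card * (P (π c)).card ∧
        (B c).card = (Q c).card * (Q (π c)).card) ∧
      (∀ i : Fin r, ∀ a ∈ A i, ∀ a' ∈ A i, ∀ b ∈ B i, ∀ b' ∈ B i,
          (a - a') + (b - b') = 0 → a = a' ∧ b = b') ∧
      (∀ i j k : Fin r, ∀ a ∈ A i, ∀ a' ∈ A j, ∀ b ∈ B j, ∀ b' ∈ B k,
          (a - a') + (b - b') = 0 → i = k) := by
  obtain ⟨p, hp, hple, A, B, hcard, hW, hX⟩ :=
    exists_prime_sdpp_of_addEquiv (graphLift_direct P Q π hD) (graphLift_cross P Q π hπ)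
      (m := fun _ : Fin 2 => m) (fun _ => hm) (AddEquiv.refl (Fin 2 → ZMod m))
  refine ⟨p, hp, ?_, A, B, fun c => ?_, hW, hX⟩
  · rw [Fin.prod_const] at hple
    calc p ≤ 2 * (3 ^ 2 * m ^ 2) := hple
      _ = 18 * m ^ 2 := by ring
  · rw [(hcard c).1, (hcard c).2, card_graphBlock, card_graphBlock]
    exact ⟨rfl, rfl⟩

/-- **Explicit exponent bookkeeping.**  For `0 < δ ≤ 1`, `ε = δ/8`, a level `m ≥ 1` with
`18 ≤ m^{5δ/8}` and `n₀² ≤ m`, the block count `n = ⌈m^{1-ε}⌉₊` satisfies `n₀ ≤ n`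
(`n₀ ≤ m^{1/2} ≤ m^{1-ε}`), `18 m² ≤ n^{2+δ}` (`18 m² ≤ m^{2+5δ/8} ≤ m^{(1-ε)(2+δ)}`, the exponent gap
being `δ(1-δ)/8 ≥ 0`) and `n^{2-δ} ≤ m^{1-ε} · m^{1-ε}` (`n ≤ 2 m^{1-ε}`, `2^{2-δ} ≤ 4 ≤ m^{5δ/8}`, and
`5δ/8 + (1-ε)(2-δ) ≤ 2 - 2ε`, the gap being `δ(3-δ)/8 ≥ 0`). -/
theorem bookkeeping {δ : ℝ} (hδ : 0 < δ) (hδ1 : δ ≤ 1) {m n₀ : ℕ} (hm : 1 ≤ m)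
    (h18 : (18 : ℝ) ≤ (m : ℝ) ^ (5 * δ / 8)) (hn₀ : n₀ ^ 2 ≤ m) :
    n₀ ≤ ⌈(m : ℝ) ^ (1 - δ / 8)⌉₊ ∧
    ((18 * m ^ 2 : ℕ) : ℝ) ≤ ((⌈(m : ℝ) ^ (1 - δ / 8)⌉₊ : ℕ) : ℝ) ^ (2 + δ) ∧
    ((⌈(m : ℝ) ^ (1 - δ / 8)⌉₊ : ℕ) : ℝ) ^ (2 - δ) ≤
      (m : ℝ) ^ (1 - δ / 8) * (m : ℝ) ^ (1 - δ / 8) := by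
  set x : ℝ := (m : ℝ) ^ (1 - δ / 8) with hx
  have hm1 : (1 : ℝ) ≤ m := by exact_mod_cast hm
  have hm0 : (0 : ℝ) < m := by linarith
  have hx1 : 1 ≤ x := Real.one_le_rpow hm1 (by linarith)
  have hx0 : 0 ≤ x := by linarith
  have hxn : x ≤ (⌈x⌉₊ : ℝ) := Nat.le_ceil x
  have hn0 : (0 : ℝ) ≤ (⌈x⌉₊ : ℝ) := Nat.cast_nonneg _
  have hn2x : (⌈x⌉₊ : ℝ) ≤ 2 * x := by
    have := Nat.ceil_lt_add_one hx0
    linarith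
  refine ⟨?_, ?_, ?_⟩
  · -- `n₀ ≤ m^{1/2} ≤ m^{1-ε} = x ≤ n`
    have h1 : ((n₀ : ℝ) ^ 2) ≤ (m : ℝ) := by exact_mod_cast hn₀
    have h2 : (n₀ : ℝ) ≤ x := by
      calc (n₀ : ℝ) = ((n₀ : ℝ) ^ 2) ^ ((2 : ℕ) : ℝ)⁻¹ :=
            (Real.pow_rpow_inv_natCast (Nat.cast_nonneg _) two_ne_zero).symm
        _ ≤ (m : ℝ) ^ ((2 : ℕ) : ℝ)⁻¹ := Real.rpow_le_rpow (by positivity) h1 (by positivity)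
        _ ≤ x := Real.rpow_le_rpow_of_exponent_le hm1 (by norm_num; linarith)
    exact_mod_cast h2.trans hxn
  · -- `18 m² ≤ m^{5δ/8} m² = m^{2 + 5δ/8} ≤ m^{(1-ε)(2+δ)} = x^{2+δ} ≤ n^{2+δ}`
    have hgap : 5 * δ / 8 + 2 ≤ (1 - δ / 8) * (2 + δ) := by nlinarith
    calc ((18 * m ^ 2 : ℕ) : ℝ) = 18 * (m : ℝ) ^ ((2 : ℕ) : ℝ) := by
          rw [Real.rpow_natCast]; push_cast; ring
      _ ≤ (m : ℝ) ^ (5 * δ / 8) * (m : ℝ) ^ ((2 : ℕ) : ℝ) :=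
          mul_le_mul_of_nonneg_right h18 (by positivity)
      _ = (m : ℝ) ^ (5 * δ / 8 + 2) := by rw [← Real.rpow_add hm0]; norm_num
      _ ≤ (m : ℝ) ^ ((1 - δ / 8) * (2 + δ)) := Real.rpow_le_rpow_of_exponent_le hm1 hgap
      _ = x ^ (2 + δ) := by rw [hx, Real.rpow_mul hm0.le]
      _ ≤ (⌈x⌉₊ : ℝ) ^ (2 + δ) := Real.rpow_le_rpow hx0 hxn (by linarith)
  · -- `n^{2-δ} ≤ (2x)^{2-δ} ≤ 4 x^{2-δ} ≤ m^{5δ/8} m^{(1-ε)(2-δ)} ≤ m^{2-2ε} = x · x`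
    have hgap : 5 * δ / 8 + (1 - δ / 8) * (2 - δ) ≤ (1 - δ / 8) + (1 - δ / 8) := by nlinarith
    have h4 : (2 : ℝ) ^ (2 - δ) ≤ (m : ℝ) ^ (5 * δ / 8) := by
      calc (2 : ℝ) ^ (2 - δ) ≤ (2 : ℝ) ^ ((2 : ℕ) : ℝ) :=
            Real.rpow_le_rpow_of_exponent_le one_le_two (by norm_num; linarith)
        _ = 4 := by rw [Real.rpow_natCast]; norm_num
        _ ≤ 18 := by norm_num
        _ ≤ (m : ℝ) ^ (5 * δ / 8) := h18
    calc (⌈x⌉₊ : ℝ) ^ (2 - δ) ≤ (2 * x) ^ (2 - δ) := Real.rpow_le_rpow hn0 hn2x (by linarith)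
      _ = (2 : ℝ) ^ (2 - δ) * x ^ (2 - δ) := Real.mul_rpow zero_le_two hx0
      _ ≤ (m : ℝ) ^ (5 * δ / 8) * x ^ (2 - δ) :=
          mul_le_mul_of_nonneg_right h4 (Real.rpow_nonneg hx0 _)
      _ = (m : ℝ) ^ (5 * δ / 8 + (1 - δ / 8) * (2 - δ)) := by
          rw [hx, ← Real.rpow_mul hm0.le, ← Real.rpow_add hm0]
      _ ≤ (m : ℝ) ^ ((1 - δ / 8) + (1 - δ / 8)) := Real.rpow_le_rpow_of_exponent_le hm1 hgap
      _ = x * x := by rw [Real.rpow_add hm0]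

/-- **Gadgets ⇒ the slice `δ` of the crux, `0 < δ ≤ 1`, explicitly.**  Apply the gadget hypothesis with
`ε = δ/8` beyond `max 1 (max n₀² ⌈18^{8/(5δ)}⌉₊)`, lift and transfer the level (`family_of_gadget`,
prime `p ≤ 18 m²`), and keep the first `n = ⌈m^{1-ε}⌉₊ ≤ r` blocks (`bookkeeping`). -/
theorem slice_of_gadgets
    (hG : ∀ ε : ℝ, 0 < ε → ∀ m₀ : ℕ, ∃ m ≥ m₀, ∃ r : ℕ, ∃ P Q : Fin r → Finset (ZMod m),
      ∃ π : Fin r → Fin r,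
      (∀ c : Fin r, ∀ x ∈ P c, ∀ x' ∈ P c, ∀ y ∈ Q c, ∀ y' ∈ Q c,
          (x - x') + (y - y') = 0 → x = x' ∧ y = y') ∧
      (∀ σ τ : Fin r, σ ≠ τ →
        (∀ p ∈ P σ, ∀ q ∈ Q τ, ∀ c : Fin r, ∀ p' ∈ P c, ∀ q' ∈ Q c, q - p ≠ q' - p') ∨
        (∀ p ∈ P (π σ), ∀ q ∈ Q (π τ), ∀ c : Fin r, ∀ p' ∈ P c, ∀ q' ∈ Q c, q - p ≠ q' - p')) ∧
      (m : ℝ) ^ (1 - ε) ≤ (r : ℝ) ∧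
      ∀ c : Fin r, (m : ℝ) ^ (1 - ε) ≤ (((P c).card * (Q c).card : ℕ) : ℝ))
    {δ : ℝ} (hδ : 0 < δ) (hδ1 : δ ≤ 1) (n₀ : ℕ) :
    ∃ n ≥ n₀, ∃ p : ℕ, p.Prime ∧ ∃ A B : Fin n → Finset (ZMod p),
      (∀ i : Fin n, ∀ a ∈ A i, ∀ a' ∈ A i, ∀ b ∈ B i, ∀ b' ∈ B i,
          (a - a') + (b - b') = 0 → a = a' ∧ b = b') ∧
      (∀ i j k : Fin n, ∀ a ∈ A i, ∀ a' ∈ A j, ∀ b ∈ B j, ∀ b' ∈ B k,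
          (a - a') + (b - b') = 0 → i = k) ∧
      (p : ℝ) ≤ (n : ℝ) ^ (2 + δ) ∧
      ∀ i : Fin n, (n : ℝ) ^ (2 - δ) ≤ (((A i).card * (B i).card : ℕ) : ℝ) := by
  have h58 : (0 : ℝ) < 5 * δ / 8 := by positivity
  set T : ℕ := ⌈(18 : ℝ) ^ (5 * δ / 8)⁻¹⌉₊ with hT
  obtain ⟨m, hm, r, P, Q, π, hD, hπ, hr, hcov⟩ :=
    hG (δ / 8) (by positivity) (max 1 (max (n₀ ^ 2) T))
  have hm1 : 1 ≤ m := le_trans (le_max_left _ _) hm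
  have hn₀ : n₀ ^ 2 ≤ m := le_trans (le_trans (le_max_left _ _) (le_max_right _ _)) hm
  have hTm : T ≤ m := le_trans (le_trans (le_max_right _ _) (le_max_right _ _)) hm
  have h18 : (18 : ℝ) ≤ (m : ℝ) ^ (5 * δ / 8) := by
    have h1 : (18 : ℝ) ^ (5 * δ / 8)⁻¹ ≤ m := (Nat.le_ceil _).trans (by exact_mod_cast hTm)
    calc (18 : ℝ) = ((18 : ℝ) ^ (5 * δ / 8)⁻¹) ^ (5 * δ / 8) :=
          (Real.rpow_inv_rpow (by norm_num) h58.ne').symm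
      _ ≤ (m : ℝ) ^ (5 * δ / 8) := Real.rpow_le_rpow (by positivity) h1 h58.le
  obtain ⟨hn₀n, hpn, hcovn⟩ := bookkeeping hδ hδ1 hm1 h18 hn₀
  set n : ℕ := ⌈(m : ℝ) ^ (1 - δ / 8)⌉₊ with hn
  have hnr : n ≤ r := Nat.ceil_le.mpr hr
  obtain ⟨p, hp, hp18, A, B, hcard, hW, hX⟩ := family_of_gadget (by omega) P Q π hD hπ
  refine ⟨n, hn₀n, p, hp, A ∘ Fin.castLE hnr, B ∘ Fin.castLE hnr, ?_, ?_, ?_, ?_⟩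
  · intro i
    exact hW (Fin.castLE hnr i)
  · intro i j k a ha a' ha' b hb b' hb' h0
    exact Fin.castLE_injective hnr (hX _ _ _ a ha a' ha' b hb b' hb' h0)
  · calc (p : ℝ) ≤ ((18 * m ^ 2 : ℕ) : ℝ) := by exact_mod_cast hp18
      _ ≤ (n : ℝ) ^ (2 + δ) := hpn
  · intro i
    simp only [Function.comp_apply]
    rw [(hcard _).1, (hcard _).2]
    calc (n : ℝ) ^ (2 - δ) ≤ (m : ℝ) ^ (1 - δ / 8) * (m : ℝ) ^ (1 - δ / 8) := hcovn
      _ ≤ (((P (Fin.castLE hnr i)).card * (Q (Fin.castLE hnr i)).card : ℕ) : ℝ) *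
            (((P (π (Fin.castLE hnr i))).card * (Q (π (Fin.castLE hnr i))).card : ℕ) : ℝ) :=
          mul_le_mul (hcov _) (hcov _) (by positivity) (by positivity)
      _ = _ := by push_cast; ring

/-- **Self-converse gadgets ↔ `PrimeTwoFamilies`** (registered stub
`selfConverseGadgets_iff_primeTwoFamilies` of crux stmt-MatrixMultiplication-14308, explicit / elementary
route).  (⇒) `slice_of_gadgets` at `min δ 1` and monotonicity of the slices in `δ` (for `n ≥ 1`).
(⇐) letter repetition (`repetition_separated` with the two projections of `Fin (n·n) ≃ Fin n × Fin n`)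
on an SDPP witness of the slice `δ = ε'/2`, `ε' = min ε 1`, in `ℤ/p`: `m = p ≥ m₀` because
`m₀ + 2 ≤ n ≤ n^{2-δ} ≤ |A i| |B i| ≤ p` (`card_mul_card_le_of_dpp`), `p^{1-ε} ≤ p^{1-ε'} ≤
n^{(2+δ)(1-ε')} ≤ n^{2-δ} ≤ |A i| |B i|`, and `n^{2-δ} ≤ n² = r`. -/
theorem selfConverseGadgets_iff_primeTwoFamilies :
    (∀ ε : ℝ, 0 < ε → ∀ m₀ : ℕ, ∃ m ≥ m₀, ∃ r : ℕ, ∃ P Q : Fin r → Finset (ZMod m),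
      ∃ π : Fin r → Fin r,
      (∀ c : Fin r, ∀ x ∈ P c, ∀ x' ∈ P c, ∀ y ∈ Q c, ∀ y' ∈ Q c,
          (x - x') + (y - y') = 0 → x = x' ∧ y = y') ∧
      (∀ σ τ : Fin r, σ ≠ τ →
        (∀ p ∈ P σ, ∀ q ∈ Q τ, ∀ c : Fin r, ∀ p' ∈ P c, ∀ q' ∈ Q c, q - p ≠ q' - p') ∨
        (∀ p ∈ P (π σ), ∀ q ∈ Q (π τ), ∀ c : Fin r, ∀ p' ∈ P c, ∀ q' ∈ Q c, q - p ≠ q' - p')) ∧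
      (m : ℝ) ^ (1 - ε) ≤ (r : ℝ) ∧
      ∀ c : Fin r, (m : ℝ) ^ (1 - ε) ≤ (((P c).card * (Q c).card : ℕ) : ℝ)) ↔
    FourierTwoFamiliesModP.PrimeTwoFamilies := by
  constructor
  · -- (⇒) gadgets give every slice
    intro hG δ hδ n₀
    obtain ⟨n, hn, p, hp, A, B, hW, hX, hpn, hcov⟩ :=
      slice_of_gadgets hG (lt_min hδ one_pos) (min_le_right δ 1) (max n₀ 1)
    have hn1 : (1 : ℝ) ≤ n := by exact_mod_cast (le_max_right n₀ 1).trans hn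
    have hδ' : min δ 1 ≤ δ := min_le_left δ 1
    refine ⟨n, (le_max_left _ _).trans hn, p, hp, A, B, hW, hX, ?_, fun i => ?_⟩
    · exact hpn.trans (Real.rpow_le_rpow_of_exponent_le hn1 (by linarith))
    · exact (Real.rpow_le_rpow_of_exponent_le hn1 (by linarith)).trans (hcov i)
  · -- (⇐) letter repetition
    intro hT ε hε m₀
    set ε' : ℝ := min ε 1 with hε'
    have hε'0 : 0 < ε' := lt_min hε one_pos
    have hε'ε : ε' ≤ ε := min_le_left _ _
    have hε'1 : ε' ≤ 1 := min_le_right _ _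
    set δ : ℝ := ε' / 2 with hδ
    have hδ0 : 0 < δ := by positivity
    obtain ⟨n, hn, p, hp, A, B, hW, hX, hpn, hAB⟩ := hT δ hδ0 (m₀ + 2)
    haveI : Fact p.Prime := ⟨hp⟩
    have hn1 : 1 ≤ n := by omega
    have hn1' : (1 : ℝ) ≤ n := by exact_mod_cast hn1
    have hp1 : (1 : ℝ) ≤ p := by exact_mod_cast hp.one_lt.le
    -- `m₀ ≤ p`: `m₀ + 2 ≤ n ≤ n^{2-δ} ≤ |A i₀| |B i₀| ≤ p`
    have i₀ : Fin n := ⟨0, by omega⟩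
    have hABp : (A i₀).card * (B i₀).card ≤ p := by
      have := card_mul_card_le_of_dpp (H := ZMod p) (hW i₀)
      rwa [ZMod.card] at this
    have hm₀ : m₀ ≤ p := by
      have h1 : (n : ℝ) ≤ (n : ℝ) ^ (2 - δ) := by
        calc (n : ℝ) = (n : ℝ) ^ (1 : ℝ) := (Real.rpow_one _).symm
          _ ≤ (n : ℝ) ^ (2 - δ) := Real.rpow_le_rpow_of_exponent_le hn1' (by linarith)
      have h2 : (n : ℝ) ≤ (p : ℝ) := (h1.trans (hAB i₀)).trans (by exact_mod_cast hABp)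
      have h3 : n ≤ p := by exact_mod_cast h2
      omega
    -- `p^{1-ε} ≤ n^{2-δ}`
    have hcov : (p : ℝ) ^ (1 - ε) ≤ (n : ℝ) ^ (2 - δ) := by
      have hgap : (2 + δ) * (1 - ε') ≤ 2 - δ := by nlinarith
      calc (p : ℝ) ^ (1 - ε) ≤ (p : ℝ) ^ (1 - ε') := Real.rpow_le_rpow_of_exponent_le hp1 (by linarith)
        _ ≤ ((n : ℝ) ^ (2 + δ)) ^ (1 - ε') :=
            Real.rpow_le_rpow (by positivity) hpn (by linarith)
        _ = (n : ℝ) ^ ((2 + δ) * (1 - ε')) := (Real.rpow_mul (by positivity) _ _).symm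
        _ ≤ (n : ℝ) ^ (2 - δ) := Real.rpow_le_rpow_of_exponent_le hn1' hgap
    -- the letters: `c ↦ (f c, g c)` through `Fin (n*n) ≃ Fin n × Fin n`, `π c = (g c, g c)`
    have e : Fin (n * n) ≃ Fin n × Fin n := finProdFinEquiv.symm
    have hsep := repetition_separated hX (fun c => (e c).1) (fun c => (e c).2)
      (fun c => e.symm ((e c).2, (e c).2))
      (fun σ τ h1 h2 => e.injective (Prod.ext h1 h2))
      (fun c => by simp only [Equiv.apply_symm_apply])
    refine ⟨p, hm₀, n * n, fun c => A (e c).1, fun c => B (e c).1,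
      fun c => e.symm ((e c).2, (e c).2), fun c => hW (e c).1, hsep, ?_,
      fun c => hcov.trans (hAB (e c).1)⟩
    -- `p^{1-ε} ≤ n^{2-δ} ≤ n² = r`
    calc (p : ℝ) ^ (1 - ε) ≤ (n : ℝ) ^ (2 - δ) := hcov
      _ ≤ (n : ℝ) ^ (2 : ℝ) := Real.rpow_le_rpow_of_exponent_le hn1' (by linarith)
      _ = ((n * n : ℕ) : ℝ) := by rw [Real.rpow_two, sq, Nat.cast_mul]

end Summit.MatrixMultiplication.MatrixMultiplication.Theorems.PrimeTwoFamilies.SelfConverseExplicitK2
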